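import Mathlib
import HarnessLib
import Summits.AtomisticToContinuum.FouriersLaw.Theses.CoercivePulse

/-!
# Birth skeleton (BC3) for crux `CoercivePulse.LinearCeiling`
(item `stmt-AtomisticToContinuum-15383`, route `route-AtomisticToContinuum-CoercivePulse`, crux rank 3;
sub-problem `FouriersLaw`; registrar `planner-skel-stmt-AtomisticToContinuum-15383-0`, 2026-08-17)

Crux (FIXED, concluded BY NAME below — `LinearCeiling_of`): DIFFUSIVE UPPER ENVELOPE OF THE HELFAND
MOMENT. For `pinnedChain ω₂ lam β γ` (`ω₂, lam, β > 0`, any `γ`), every `T > 0`, every shift- and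
momentum-reversal-invariant DLR Gibbs state `μ_T`, every `μ_T`-preserving a.e. shift-covariant
infinite-volume dynamics `D`, with split-bond site energy `h_x` and averaged energy pulse
`S(x,t) = Cov(h_0, h_x ∘ φ_t)`: if `Σ_x (1+x²)|S(x,t)| < ∞` at every `t`, there are `b, t₃` with
`M(t) ≤ M(t₃) + b (t − t₃)` for all `t ≥ t₃`, `M(t) = Σ_x x² S(x,t)`.

## Line `birth` — OHM CEILING × PULSE MOMENT CALCULUS (the route's own recorded first line of attack,
two-layer plan of the route header: `LinearCeiling ⇐ OhmCeiling + F-side pulse calculus`, glued by the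
Ohm upper-envelope lemma, which is PROVED here, sorry-free, as `Glue.momentRate_le` +
`Glue.envelope_of_rate_le`)

* `stub_ohmCeiling` — OHM CEILING WITH OUTWARD MONOTONICITY, defect form (VERBATIM the former route
  item `OhmCeiling`, stmt-AtomisticToContinuum-15156, grounded NEW/open by grounder g45-0, dropped from the
  deciding theorem by the crux-only repair of 2026-08-16 and kept in the route header as the first line of
  attack on this crux): with the response current `F(x,t) = Cov(h_0, j_x ∘ φ_t)` there are `t₀`, `Λ ≥ 0`,
  `η` such that for every `t ≥ t₀` there is a defect set `B ⊂ ℤ` of bonds OFF which the pulse is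
  outward-monotone (`(2x+1)(S(x,t) − S(x+1,t)) ≥ 0`), the response current runs down-gradient
  (`(2x+1)F(x,t) ≥ 0`) with conductance ratio at most `Λ` (`(2x+1)F ≤ Λ(2x+1)(S(x)−S(x+1))`), while the
  defect bonds carry a bounded `|x|`-weighted budget `Σ_{x∈B} |2x+1|(|F| + Λ|∇S|) ≤ η`.  Size XL (open;
  the response-ellipticity conjecture of card response-conductance-nash-muckenhoupt, K2).
* `stub_pulseMomentCalculus` — F-SIDE INFINITE-VOLUME CALCULUS OF THE PULSE (the `F`-twin of the route
  crux `PulseCalculus`, stmt-AtomisticToContinuum-15385; exactly the "dropped conjuncts of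
  PulseIdentities/PulseRegularity" the route header names for this split): under the crux's own
  summability guard `Σ(1+x²)|S| < ∞`: energy conservation `Σ_x S(x,t) = Σ_x S(x,0)` (from
  `ḣ_x = j_{x−1} − j_x`), weighted summability `Σ(1+|x|)|F(x,t)| < ∞` (light cone + Gibbs clustering),
  continuity of the moment production `t ↦ Σ(2x+1)F(x,t)`, and the moment identity
  `M(t₂) − M(t₁) = ∫_{t₁}^{t₂} Σ_x (2x+1)F(x,s) ds` (`M′ = Σ x²(F(x−1)−F(x)) = Σ(2x+1)F`).  Size L.
* COMPOSITION `LinearCeiling_of : stub_ohmCeiling → stub_pulseMomentCalculus → CoercivePulse.LinearCeiling`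
  (sorry-free; axioms propext / Classical.choice / Quot.sound): at each `t ≥ t₀`, off `B` the weighted
  current is `≤ Λ ×` the weighted decrement and on `B` both sit inside the budget, so
  `Σ(2x+1)F − ΛΣ(2x+1)(S(x)−S(x+1)) ≤ η`; the reindexing identity `Σ(2x+1)(S(x)−S(x+1)) = 2ΣS = 2χ`
  (`Glue.tsum_weight_mul_sub_shift`) gives the RATE BOUND `M′ ≤ 2Λχ + η` (`Glue.momentRate_le`), and
  integrating the moment identity gives `M(t) ≤ M(t₀) + (2Λχ + η)(t − t₀)` (`Glue.envelope_of_rate_le`):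
  `b = 2Λχ + η`, `t₃ = t₀`, `χ = Σ_x S(x,0)`.  About 150 lines of real analysis (weighted summability
  on `ℤ`, shift reindexing, indicator budgets, interval-integral monotonicity) — not `exact ⟨h₁, h₂⟩`.

Hardest stub: `stub_ohmCeiling` (it carries the crux's structural content: a SIGN + RATIO statement on
two covariance kernels of the deterministic quartic chain at all late times; why it might fail — the
item's own: super-diffusive episodes / precursor fronts make the weighted defect budget grow, as it does
(∝ t) at the harmonic member, card job j002001). `stub_pulseMomentCalculus` is infrastructure of size L
(light-cone bound for the `deg V′ = 3` infinite dynamics composed with 1-D Gibbs clustering, plus the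
sum/derivative exchanges), shared in kind with the route crux `PulseCalculus`.
Why the cut is not a costume: `stub_ohmCeiling` alone says nothing about `M` (no moment identity, no
summability of `F`), `stub_pulseMomentCalculus` alone allows any growth of `M` (no bound on the rate
`Σ(2x+1)F`); neither is the crux reworded, and the crux (an envelope) gives neither the pointwise sign
structure of `stub_ohmCeiling` nor the identities of `stub_pulseMomentCalculus`.  BC3 probes
`stub → LinearCeiling`, `stub → FouriersLaw` by `first | exact? | simpa | aesop` FAIL for both stubs
(planner folder `bc/probe_*.lean`, verdicts quoted in `Lines/birth.md`).
Disproof used: none on file (`ledger crux ls stmt-AtomisticToContinuum-15383`: no workfiles before this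
one — no `Disproof.lean`, no `Negative/` lemma, 2026-08-17); negatives index: the two refuted
`FouriersLaw` statements (OddCorrectorDecay stmt-9139, DiluteCell far-field Gaussianity stmt-12890)
concern other objects; neither stub is an instance of them.
-/

noncomputable section

namespace Summit.AtomisticToContinuum.FouriersLaw.Cruxes.LinearCeiling.Birth

open MeasureTheory Filter Set
open scoped BigOperators Topology

/-! ## Part I — the glue, proved (pure real analysis on `ℤ`-indexed sums and interval integrals) -/

namespace Glue


/-- `|2x+1| ≤ 2(1+|x|)`. -/
theorem abs_two_mul_add_one_le_abs (x : ℝ) : |2 * x + 1| ≤ 2 * (1 + |x|) := by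
  calc |2 * x + 1| ≤ |2 * x| + |1| := abs_add_le _ _
    _ = 2 * |x| + 1 := by rw [abs_mul, abs_two, abs_one]
    _ ≤ 2 * (1 + |x|) := by linarith [abs_nonneg x]

/-- `|2x+1| ≤ 2(1+x²)`. -/
theorem abs_two_mul_add_one_le_sq (x : ℝ) : |2 * x + 1| ≤ 2 * (1 + x ^ 2) := by
  rw [abs_le]
  constructor <;> nlinarith [sq_nonneg (x + 1), sq_nonneg (x - 1), sq_nonneg x]

/-- `|2x-1| ≤ 2(1+x²)`. -/
theorem abs_two_mul_sub_one_le_sq (x : ℝ) : |2 * x - 1| ≤ 2 * (1 + x ^ 2) := by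
  rw [abs_le]
  constructor <;> nlinarith [sq_nonneg (x + 1), sq_nonneg (x - 1), sq_nonneg x]

/-- Weighted summability of the current gives summability of `(2x+1)F`. -/
theorem summable_weight_mul_of_abs {F : ℤ → ℝ}
    (hF : Summable fun x : ℤ => (1 + |(x : ℝ)|) * |F x|) :
    Summable fun x : ℤ => (2 * (x : ℝ) + 1) * F x := by
  refine Summable.of_norm_bounded (hF.mul_left 2) fun x => ?_
  rw [Real.norm_eq_abs, abs_mul]
  calc |2 * (x : ℝ) + 1| * |F x| ≤ 2 * (1 + |(x : ℝ)|) * |F x| :=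
        mul_le_mul_of_nonneg_right (abs_two_mul_add_one_le_abs _) (abs_nonneg _)
    _ = 2 * ((1 + |(x : ℝ)|) * |F x|) := by ring

/-- Summability of `|2x+1| |F x|`. -/
theorem summable_absweight_mul_abs {F : ℤ → ℝ}
    (hF : Summable fun x : ℤ => (1 + |(x : ℝ)|) * |F x|) :
    Summable fun x : ℤ => |2 * (x : ℝ) + 1| * |F x| := by
  refine Summable.of_nonneg_of_le (fun x => by positivity) (fun x => ?_) (hF.mul_left 2)
  calc |2 * (x : ℝ) + 1| * |F x| ≤ 2 * (1 + |(x : ℝ)|) * |F x| :=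
        mul_le_mul_of_nonneg_right (abs_two_mul_add_one_le_abs _) (abs_nonneg _)
    _ = 2 * ((1 + |(x : ℝ)|) * |F x|) := by ring

/-- Second-moment summability of the pulse gives summability of `(2x+1) S x`. -/
theorem summable_weight_mul_of_sq {S : ℤ → ℝ}
    (hS : Summable fun x : ℤ => (1 + (x : ℝ) ^ 2) * |S x|) :
    Summable fun x : ℤ => (2 * (x : ℝ) + 1) * S x := by
  refine Summable.of_norm_bounded (hS.mul_left 2) fun x => ?_
  rw [Real.norm_eq_abs, abs_mul]
  calc |2 * (x : ℝ) + 1| * |S x| ≤ 2 * (1 + (x : ℝ) ^ 2) * |S x| :=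
        mul_le_mul_of_nonneg_right (abs_two_mul_add_one_le_sq _) (abs_nonneg _)
    _ = 2 * ((1 + (x : ℝ) ^ 2) * |S x|) := by ring

/-- … and of `(2x-1) S x`. -/
theorem summable_weight'_mul_of_sq {S : ℤ → ℝ}
    (hS : Summable fun x : ℤ => (1 + (x : ℝ) ^ 2) * |S x|) :
    Summable fun x : ℤ => (2 * (x : ℝ) - 1) * S x := by
  refine Summable.of_norm_bounded (hS.mul_left 2) fun x => ?_
  rw [Real.norm_eq_abs, abs_mul]
  calc |2 * (x : ℝ) - 1| * |S x| ≤ 2 * (1 + (x : ℝ) ^ 2) * |S x| :=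
        mul_le_mul_of_nonneg_right (abs_two_mul_sub_one_le_sq _) (abs_nonneg _)
    _ = 2 * ((1 + (x : ℝ) ^ 2) * |S x|) := by ring

/-- … and of `|2x+1| |S x|`, `|2x-1| |S x|`. -/
theorem summable_absweight_mul_abs_of_sq {S : ℤ → ℝ}
    (hS : Summable fun x : ℤ => (1 + (x : ℝ) ^ 2) * |S x|) :
    Summable fun x : ℤ => |2 * (x : ℝ) + 1| * |S x| := by
  refine Summable.of_nonneg_of_le (fun x => by positivity) (fun x => ?_) (hS.mul_left 2)
  calc |2 * (x : ℝ) + 1| * |S x| ≤ 2 * (1 + (x : ℝ) ^ 2) * |S x| :=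
        mul_le_mul_of_nonneg_right (abs_two_mul_add_one_le_sq _) (abs_nonneg _)
    _ = 2 * ((1 + (x : ℝ) ^ 2) * |S x|) := by ring

theorem summable_absweight'_mul_abs_of_sq {S : ℤ → ℝ}
    (hS : Summable fun x : ℤ => (1 + (x : ℝ) ^ 2) * |S x|) :
    Summable fun x : ℤ => |2 * (x : ℝ) - 1| * |S x| := by
  refine Summable.of_nonneg_of_le (fun x => by positivity) (fun x => ?_) (hS.mul_left 2)
  calc |2 * (x : ℝ) - 1| * |S x| ≤ 2 * (1 + (x : ℝ) ^ 2) * |S x| :=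
        mul_le_mul_of_nonneg_right (abs_two_mul_sub_one_le_sq _) (abs_nonneg _)
    _ = 2 * ((1 + (x : ℝ) ^ 2) * |S x|) := by ring

/-- **Reindexing identity** `Σ_x (2x+1)(S x − S (x+1)) = 2 Σ_x S x` (the weight `(x+1)² − x²`
telescopes against the shift). -/
theorem tsum_weight_mul_sub_shift {S : ℤ → ℝ}
    (hS : Summable fun x : ℤ => (1 + (x : ℝ) ^ 2) * |S x|) :
    ∑' x : ℤ, (2 * (x : ℝ) + 1) * (S x - S (x + 1)) = 2 * ∑' x : ℤ, S x := by
  have h1 : Summable fun x : ℤ => (2 * (x : ℝ) + 1) * S x := summable_weight_mul_of_sq hS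
  have h2' : Summable fun x : ℤ => (2 * (x : ℝ) - 1) * S x := summable_weight'_mul_of_sq hS
  -- the shifted family `x ↦ (2x+1) S (x+1)` is `y ↦ (2y-1) S y` reindexed by `y = x + 1`
  have h2 : Summable fun x : ℤ => (2 * (x : ℝ) + 1) * S (x + 1) := by
    refine (h2'.comp_injective (add_left_injective (1 : ℤ))).congr fun x => ?_
    simp only [Function.comp_apply, Int.cast_add, Int.cast_one]
    ring
  have h2t : ∑' x : ℤ, (2 * (x : ℝ) + 1) * S (x + 1) = ∑' y : ℤ, (2 * (y : ℝ) - 1) * S y := by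
    have e := (Equiv.addRight (1 : ℤ)).tsum_eq (fun y : ℤ => (2 * (y : ℝ) - 1) * S y)
    simp only [Equiv.coe_addRight, Int.cast_add, Int.cast_one] at e
    rw [← e]
    exact tsum_congr fun x => by ring
  calc ∑' x : ℤ, (2 * (x : ℝ) + 1) * (S x - S (x + 1))
      = ∑' x : ℤ, ((2 * (x : ℝ) + 1) * S x - (2 * (x : ℝ) + 1) * S (x + 1)) :=
        tsum_congr fun x => by ring
    _ = ∑' x : ℤ, (2 * (x : ℝ) + 1) * S x - ∑' x : ℤ, (2 * (x : ℝ) + 1) * S (x + 1) :=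
        Summable.tsum_sub h1 h2
    _ = ∑' x : ℤ, (2 * (x : ℝ) + 1) * S x - ∑' y : ℤ, (2 * (y : ℝ) - 1) * S y := by rw [h2t]
    _ = ∑' x : ℤ, ((2 * (x : ℝ) + 1) * S x - (2 * (x : ℝ) - 1) * S x) :=
        (Summable.tsum_sub h1 h2').symm
    _ = ∑' x : ℤ, 2 * S x := tsum_congr fun x => by ring
    _ = 2 * ∑' x : ℤ, S x := tsum_mul_left

/-- **Ohm ceiling ⇒ bound on the moment production rate** (fixed time): off the defect set `B` the
weighted current is at most `Λ ×` the weighted decrement, on `B` both sit inside the budget; summing,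
`Σ (2x+1) F ≤ Λ Σ (2x+1)(S x − S(x+1)) + η = 2Λ Σ S + η`. -/
theorem momentRate_le {S F : ℤ → ℝ} {Λ η : ℝ} (hΛ : 0 ≤ Λ)
    (hS : Summable fun x : ℤ => (1 + (x : ℝ) ^ 2) * |S x|)
    (hF : Summable fun x : ℤ => (1 + |(x : ℝ)|) * |F x|) (B : Set ℤ)
    (hoff : ∀ x : ℤ, x ∉ B → 0 ≤ (2 * (x : ℝ) + 1) * (S x - S (x + 1)) ∧
      0 ≤ (2 * (x : ℝ) + 1) * F x ∧
      (2 * (x : ℝ) + 1) * F x ≤ Λ * ((2 * (x : ℝ) + 1) * (S x - S (x + 1))))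
    (hbudget : ∑' x : ℤ, B.indicator
      (fun x : ℤ => |2 * (x : ℝ) + 1| * (|F x| + Λ * |S x - S (x + 1)|)) x ≤ η) :
    ∑' x : ℤ, (2 * (x : ℝ) + 1) * F x ≤ 2 * Λ * (∑' x : ℤ, S x) + η := by
  -- summabilities
  have hf : Summable fun x : ℤ => (2 * (x : ℝ) + 1) * F x := summable_weight_mul_of_abs hF
  have ha1 : Summable fun x : ℤ => (2 * (x : ℝ) + 1) * S x := summable_weight_mul_of_sq hS
  have ha2 : Summable fun x : ℤ => (2 * (x : ℝ) + 1) * S (x + 1) := by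
    refine ((summable_weight'_mul_of_sq hS).comp_injective (add_left_injective (1 : ℤ))).congr
      fun x => ?_
    simp only [Function.comp_apply, Int.cast_add, Int.cast_one]
    ring
  have ha : Summable fun x : ℤ => (2 * (x : ℝ) + 1) * (S x - S (x + 1)) := by
    have := ha1.sub ha2
    refine this.congr fun x => ?_
    ring
  -- the budget density is summable (without the indicator), hence with it
  have hb2 : Summable fun x : ℤ => |2 * (x : ℝ) + 1| * |S (x + 1)| := by
    refine ((summable_absweight'_mul_abs_of_sq hS).comp_injective
      (add_left_injective (1 : ℤ))).congr fun x => ?_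
    simp only [Function.comp_apply, Int.cast_add, Int.cast_one]
    ring_nf
  have hdens : Summable fun x : ℤ => |2 * (x : ℝ) + 1| * (|F x| + Λ * |S x - S (x + 1)|) := by
    have hsum : Summable fun x : ℤ => |2 * (x : ℝ) + 1| * |F x| +
        Λ * (|2 * (x : ℝ) + 1| * |S x| + |2 * (x : ℝ) + 1| * |S (x + 1)|) :=
      (summable_absweight_mul_abs hF).add (((summable_absweight_mul_abs_of_sq hS).add hb2).mul_left Λ)
    refine Summable.of_nonneg_of_le (fun x => by positivity) (fun x => ?_) hsum
    have h3 : |S x - S (x + 1)| ≤ |S x| + |S (x + 1)| := abs_sub _ _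
    have h4 : 0 ≤ |2 * (x : ℝ) + 1| := abs_nonneg _
    nlinarith [mul_le_mul_of_nonneg_left h3 (mul_nonneg h4 hΛ)]
  have hind : Summable (B.indicator fun x : ℤ => |2 * (x : ℝ) + 1| * (|F x| + Λ * |S x - S (x + 1)|)) :=
    hdens.indicator B
  -- pointwise: weighted current − Λ × weighted decrement ≤ budget density on B, ≤ 0 off B
  have hpt : ∀ x : ℤ, (2 * (x : ℝ) + 1) * F x - Λ * ((2 * (x : ℝ) + 1) * (S x - S (x + 1))) ≤
      B.indicator (fun x : ℤ => |2 * (x : ℝ) + 1| * (|F x| + Λ * |S x - S (x + 1)|)) x := by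
    intro x
    by_cases hx : x ∈ B
    · rw [Set.indicator_of_mem hx]
      have e1 : (2 * (x : ℝ) + 1) * F x ≤ |2 * (x : ℝ) + 1| * |F x| := by
        rw [← abs_mul]; exact le_abs_self _
      have e2 : -(Λ * ((2 * (x : ℝ) + 1) * (S x - S (x + 1)))) ≤
          Λ * (|2 * (x : ℝ) + 1| * |S x - S (x + 1)|) := by
        rw [← abs_mul, ← mul_neg]
        exact mul_le_mul_of_nonneg_left (neg_le_abs _) hΛ
      nlinarith [e1, e2]
    · rw [Set.indicator_of_notMem hx]
      linarith [(hoff x hx).2.2]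
  -- sum it
  have hsum := Summable.tsum_le_tsum hpt (hf.sub (ha.mul_left Λ)) hind
  rw [Summable.tsum_sub hf (ha.mul_left Λ), tsum_mul_left, tsum_weight_mul_sub_shift hS] at hsum
  linarith

/-- **Linear envelope from a rate bound**: if `M t₂ − M t₁ = ∫_{t₁}^{t₂} G` with `G` continuous and
`G ≤ c` on `[t₀, ∞)`, then `M t ≤ M t₀ + c (t − t₀)` for `t ≥ t₀`. -/
theorem envelope_of_rate_le {M G : ℝ → ℝ} {t₀ c : ℝ} (hG : Continuous G)
    (hmom : ∀ t₁ t₂ : ℝ, t₁ ≤ t₂ → M t₂ - M t₁ = ∫ s in t₁..t₂, G s)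
    (hle : ∀ s : ℝ, t₀ ≤ s → G s ≤ c) :
    ∀ t : ℝ, t₀ ≤ t → M t ≤ M t₀ + c * (t - t₀) := by
  intro t ht
  have h1 : ∫ s in t₀..t, G s ≤ ∫ _ in t₀..t, c :=
    intervalIntegral.integral_mono_on ht (hG.intervalIntegrable _ _) intervalIntegrable_const
      fun s hs => hle s hs.1
  rw [intervalIntegral.integral_const, smul_eq_mul, ← hmom t₀ t ht] at h1
  linarith


end Glue

/-! ## Part II — registered stubs (the two lemmas of the line; `sorry` only here)

Device of `Cruxes/BoundedResponse/Lines/birth.lean`: each stub is a sorried theorem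
`Holds.stub_<name> : <full statement over tree declarations> := by sorry` (registered by
`ledger skeleton check` under the short name `stub_<name>` with THAT text as signature) plus the by-name
handle `def stub_<name> : Prop := type_of% Holds.stub_<name>` which the layer-invariant audit
(`#h21_check_skeleton`) requires of the hypotheses of `LinearCeiling_of`. -/

/-- **Stub 1 — `stub_ohmCeiling` (OHM CEILING WITH OUTWARD MONOTONICITY, defect form; size XL; the
load-bearing stub).** Same arena and guard as the crux, plus the response current
`F(x,t) = Cov(h_0, j_x ∘ φ_t)` (`j_x = bondCurrentZ`): there are `t₀`, `Λ ≥ 0`, `η` such that for every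
`t ≥ t₀` there is a defect set `B ⊂ ℤ` off which `(2x+1)(S(x,t) − S(x+1,t)) ≥ 0`, `(2x+1)F(x,t) ≥ 0` and
`(2x+1)F(x,t) ≤ Λ (2x+1)(S(x,t) − S(x+1,t))`, while `Σ_{x∈B} |2x+1|(|F(x,t)| + Λ|S(x,t) − S(x+1,t)|) ≤ η`.
VERBATIM the former route item `CoercivePulse.OhmCeiling` (stmt-AtomisticToContinuum-15156; card
response-conductance-nash-muckenhoupt K2 = (UE_Λ)). Why plausibly true: it is the averaged-response form
of "the energy pulse of a diffusive medium runs down its own gradient with bounded conductance" —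
exact (with `η → 0`, `Λ = D`) for the diffusive calibration `S = χ(4πDt)^{-1/2}e^{-x²/4Dt}`; FALSE at the
harmonic member `lam = β = 0` (coherent fronts, budget ∝ t), which the hypotheses exclude. Why it might
fail: super-diffusive episodes (quasi-conserved phonon mode, rare supersonic quartic-bond pulses) could
make the weighted defect budget unbounded along a sequence of times. Sources: doi:10.1214/19-ejp348,
doi:10.1007/s00440-005-0430-y, arXiv:1103.2835, Helfand1960, Dhar2008. -/
theorem Holds.stub_ohmCeiling :
    ∀ ω₂ lam β γ : ℝ, 0 < ω₂ → 0 < lam → 0 < β → ∀ T : ℝ, 0 < T → ∀ μ : MeasureTheory.Measure Literature.MathematicalPhysics.KineticTheory.HeatConduction.ChainConfig, (Literature.MathematicalPhysics.KineticTheory.HeatConduction.pinnedChain ω₂ lam β γ).IsChainGibbsMeasure T μ → Literature.MathematicalPhysics.KineticTheory.HeatConduction.IsShiftInvariant μ → μ.map (fun σ : Literature.MathematicalPhysics.KineticTheory.HeatConduction.ChainConfig => fun x : ℤ => ((σ x).1, -(σ x).2)) = μ → ∀ D : Literature.MathematicalPhysics.KineticTheory.HeatConduction.InfiniteChainDynamics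 (Literature.MathematicalPhysics.KineticTheory.HeatConduction.pinnedChain ω₂ lam β γ), D.PreservesMeasure μ → (∀ t : ℝ, ∀ᵐ σ ∂μ, D.flow t (Literature.MathematicalPhysics.KineticTheory.HeatConduction.shift σ) = Literature.MathematicalPhysics.KineticTheory.HeatConduction.shift (D.flow t σ)) → ∀ h : Literature.MathematicalPhysics.KineticTheory.HeatConduction.ChainConfig → ℤ → ℝ, h = (fun (σ : Literature.MathematicalPhysics.KineticTheory.HeatConduction.ChainConfig) (x : ℤ) => (σ x).2 ^ 2 / 2 + (Literature.MathematicalPhysics.KineticTheory.HeatConduction.pinnedChain ω₂ lam β γ).U (σ x).1 + ((Literature.MathematicalPhysics.KineticTheory.HeatConduction.pinnedChain ω₂ lam β γ).V ((σ (x + 1)).1 - (σ x).1) + (Literature.MathematicalPhysics.KineticTheory.HeatConduction.pinnedChain ω₂ lam β γ).V ((σ x).1 - (σ (x - 1)).1)) / 2) → ∀ S : ℤ → ℝ → ℝ, S = (fun (x : ℤ) (t : ℝ) => ∫ σ, (h σ 0 - ∫ σ', h σ' 0 ∂μ) * (h (D.flow t σ) x - ∫ σ', h σ' 0 ∂μ)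 ∂μ) → ∀ F : ℤ → ℝ → ℝ, F = (fun (x : ℤ) (t : ℝ) => ∫ σ, (h σ 0 - ∫ σ', h σ' 0 ∂μ) * (Literature.MathematicalPhysics.KineticTheory.HeatConduction.pinnedChain ω₂ lam β γ).bondCurrentZ (D.flow t σ) x ∂μ) → ∃ t₀ Λ η : ℝ, 0 ≤ Λ ∧ ∀ t : ℝ, t₀ ≤ t → ∃ B : Set ℤ, (∀ x : ℤ, x ∉ B → 0 ≤ (2 * (x : ℝ) + 1) * (S x t - S (x + 1) t) ∧ 0 ≤ (2 * (x : ℝ) + 1) * F x t ∧ (2 * (x : ℝ) + 1) * F x t ≤ Λ * ((2 * (x : ℝ) + 1) * (S x t - S (x + 1) t))) ∧ ∑' x : ℤ, B.indicator (fun x : ℤ => |2 * (x : ℝ) + 1| * (|F x t| + Λ * |S x t - S (x + 1) t|)) x ≤ η := by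
  sorry

/-- **Stub 2 — `stub_pulseMomentCalculus` (F-SIDE INFINITE-VOLUME CALCULUS OF THE PULSE; size L).**
Same arena, guard and response current as stub 1; under the crux's hypothesis `Σ_x(1+x²)|S(x,t)| < ∞`
at every `t`: (i) energy conservation `Σ_x S(x,t) = Σ_x S(x,0)`; (ii) `Σ_x (1+|x|)|F(x,t)| < ∞` at every
`t`; (iii) `t ↦ Σ_x (2x+1)F(x,t)` is continuous; (iv) the moment identity
`M(t₂) − M(t₁) = ∫_{t₁}^{t₂} Σ_x (2x+1)F(x,s) ds` for `t₁ ≤ t₂`, `M(t) = Σ_x x²S(x,t)` (from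
`∂ₜS(x,t) = F(x−1,t) − F(x,t)`, i.e. `ḣ_x = j_{x−1} − j_x`, and `(x+1)² − x² = 2x+1`). The `F`-twin of
the route crux `CoercivePulse.PulseCalculus` (stmt-AtomisticToContinuum-15385) — exactly the "dropped
conjuncts of PulseIdentities / PulseRegularity" which the route header's two-layer plan names for this
split. Why plausibly true: standard for finite chains; in infinite volume it is a light-cone bound for
the `deg V′ = 3` dynamics composed with exponential clustering of the 1-D Gibbs state, plus dominated
sum/derivative exchanges. Why it might fail (as typed): a missing moment / temperedness guard on the
guarded Gibbs state (then a misstatement to be repaired route-wide, shared with `PulseCalculus`).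
Sources: LanfordLebowitzLieb1977, ButtaMarchioro2016, Helfand1960, arXiv:1103.2835,
BonettoLebowitzReyBellet2000. -/
theorem Holds.stub_pulseMomentCalculus :
    ∀ ω₂ lam β γ : ℝ, 0 < ω₂ → 0 < lam → 0 < β → ∀ T : ℝ, 0 < T → ∀ μ : MeasureTheory.Measure Literature.MathematicalPhysics.KineticTheory.HeatConduction.ChainConfig, (Literature.MathematicalPhysics.KineticTheory.HeatConduction.pinnedChain ω₂ lam β γ).IsChainGibbsMeasure T μ → Literature.MathematicalPhysics.KineticTheory.HeatConduction.IsShiftInvariant μ → μ.map (fun σ : Literature.MathematicalPhysics.KineticTheory.HeatConduction.ChainConfig => fun x : ℤ => ((σ x).1, -(σ x).2)) = μ → ∀ D : Literature.MathematicalPhysics.KineticTheory.HeatConduction.InfiniteChainDynamics (Literature.MathematicalPhysics.KineticTheory.HeatConduction.pinnedChain ω₂ lam β γ), D.PreservesMeasure μ → (∀ t : ℝ, ∀ᵐ σ ∂μ, D.flow t (Literature.MathematicalPhysics.KineticTheory.HeatConduction.shift σ) = Literature.MathematicalPhysics.KineticTheory.HeatConduction.shift (D.flow t σ)) → ∀ h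 : Literature.MathematicalPhysics.KineticTheory.HeatConduction.ChainConfig → ℤ → ℝ, h = (fun (σ : Literature.MathematicalPhysics.KineticTheory.HeatConduction.ChainConfig) (x : ℤ) => (σ x).2 ^ 2 / 2 + (Literature.MathematicalPhysics.KineticTheory.HeatConduction.pinnedChain ω₂ lam β γ).U (σ x).1 + ((Literature.MathematicalPhysics.KineticTheory.HeatConduction.pinnedChain ω₂ lam β γ).V ((σ (x + 1)).1 - (σ x).1) + (Literature.MathematicalPhysics.KineticTheory.HeatConduction.pinnedChain ω₂ lam β γ).V ((σ x).1 - (σ (x - 1)).1)) / 2) → ∀ S : ℤ → ℝ → ℝ, S = (fun (x : ℤ) (t : ℝ) => ∫ σ, (h σ 0 - ∫ σ', h σ' 0 ∂μ) * (h (D.flow t σ) x - ∫ σ', h σ' 0 ∂μ) ∂μ) → ∀ F : ℤ → ℝ → ℝ, F = (fun (x : ℤ) (t : ℝ) => ∫ σ, (h σ 0 - ∫ σ', h σ' 0 ∂μ) * (Literature.MathematicalPhysics.KineticTheory.HeatConduction.pinnedChain ω₂ lam β γ).bondCurrentZ (D.flow t σ) x ∂μ) → (∀ t : ℝ, Summable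 (fun x : ℤ => (1 + (x : ℝ) ^ 2) * |S x t|)) → (∀ t : ℝ, ∑' x : ℤ, S x t = ∑' x : ℤ, S x 0) ∧ (∀ t : ℝ, Summable (fun x : ℤ => (1 + |(x : ℝ)|) * |F x t|)) ∧ Continuous (fun t : ℝ => ∑' x : ℤ, (2 * (x : ℝ) + 1) * F x t) ∧ (∀ t₁ t₂ : ℝ, t₁ ≤ t₂ → (∑' x : ℤ, (x : ℝ) ^ 2 * S x t₂) - (∑' x : ℤ, (x : ℝ) ^ 2 * S x t₁) = ∫ s in t₁..t₂, ∑' x : ℤ, (2 * (x : ℝ) + 1) * F x s) := by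
  sorry

/-! ### By-name handles of the two statements (no second copy of the text) -/

/-- Statement of registered stub 1 (`Holds.stub_ohmCeiling`), by name. -/
def stub_ohmCeiling : Prop := type_of% Holds.stub_ohmCeiling

/-- Statement of registered stub 2 (`Holds.stub_pulseMomentCalculus`), by name. -/
def stub_pulseMomentCalculus : Prop := type_of% Holds.stub_pulseMomentCalculus

/-! ## Part III — the skeleton theorem: the two stubs give the crux BY NAME (sorry-free) -/

/-- **`LinearCeiling_of`** — `stub_ohmCeiling → stub_pulseMomentCalculus → CoercivePulse.LinearCeiling`
(kernel-checked; axioms propext / Classical.choice / Quot.sound). For `t ≥ t₀` (the onset time of the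
Ohm ceiling): rate bound `Σ(2x+1)F(·,t) ≤ 2Λχ + η` (`Glue.momentRate_le` with energy conservation
`Σ_x S(x,t) = χ := Σ_x S(x,0)`), then the moment identity integrates it to
`M(t) ≤ M(t₀) + (2Λχ + η)(t − t₀)` (`Glue.envelope_of_rate_le`): `b = 2Λχ + η`, `t₃ = t₀`. [folklore] -/
theorem LinearCeiling_of (h₁ : stub_ohmCeiling) (h₂ : stub_pulseMomentCalculus) :
    _root_.Summit.AtomisticToContinuum.FouriersLaw.Theses.CoercivePulse.LinearCeiling := by
  intro ω₂ lam β γ hω hl hβ T hT μ hG hSI hR D hP hSh h hh S hS hSum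
  obtain ⟨t₀, Λ, η, hΛ, hOhm⟩ := h₁ ω₂ lam β γ hω hl hβ T hT μ hG hSI hR D hP hSh h hh S hS _ rfl
  obtain ⟨hcons, hFsum, hcont, hmom⟩ :=
    h₂ ω₂ lam β γ hω hl hβ T hT μ hG hSI hR D hP hSh h hh S hS _ rfl hSum
  refine ⟨2 * Λ * (∑' x : ℤ, S x 0) + η, t₀, ?_⟩
  refine Glue.envelope_of_rate_le (M := fun t : ℝ => ∑' x : ℤ, (x : ℝ) ^ 2 * S x t)
    (G := fun t : ℝ => ∑' x : ℤ, (2 * (x : ℝ) + 1) *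
      (∫ σ, (h σ 0 - ∫ σ', h σ' 0 ∂μ) *
        (Literature.MathematicalPhysics.KineticTheory.HeatConduction.pinnedChain ω₂ lam β γ).bondCurrentZ
          (D.flow t σ) x ∂μ)) hcont hmom fun s hs => ?_
  obtain ⟨B, hoff, hbudget⟩ := hOhm s hs
  have key := Glue.momentRate_le hΛ (hSum s) (hFsum s) B hoff hbudget
  rw [hcons s] at key
  exact key

/-- D-0027 §3.3 shape: the crux from the registered stubs (an `example`, so that `LinearCeiling_of`
stays the unique theorem concluding the crux; it becomes a proof once the two `sorry`s are discharged). -/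
example : _root_.Summit.AtomisticToContinuum.FouriersLaw.Theses.CoercivePulse.LinearCeiling :=
  LinearCeiling_of Holds.stub_ohmCeiling Holds.stub_pulseMomentCalculus

end Summit.AtomisticToContinuum.FouriersLaw.Cruxes.LinearCeiling.Birth

end
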